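import Literature.NumberTheory.IwasawaTheory.ClassicalMuVanishesKleinDescentNoGrowth
import Literature.NumberTheory.IwasawaTheory.ClassicalMuVanishesDivisionFieldThree
import HarnessLib

set_option autoImplicit false

/-!
# `μ = 0` for `ℚ(E[3])_cyc` from `μ(ℚ(P)) = 0` ALONE on the non-split-Cartan-normaliser rows — WITHOUT Iwasawa's growth theorem

Topic `NumberTheory/IwasawaTheory` (namespace = path). THEOREM-ONLY file (no definition, no named fact, no `sorry`), written by the
prover seat `bsd-potss-k8t-c4` g22 (cell `bsd-potss`; μ-road of stmt-BirchSwinnertonDyer-19982; closes nothing).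

hI-FREE TWINS of the «input `ℚ(P)` alone» (primed) forms of `ClassicalMuVanishesNonsplitCartanImage` /
`ClassicalMuVanishesDivisionFieldThree` (seat `bsd-potss-conjA-anchor` g11), which paid `iwasawa1959_classNumberPExp_growth` for the
`p`-prime-index step `ℚ(x(P)) ⊆ ℚ(P)` (index `2`, `p = 3`).  Here that step is `classicalMuVanishes_of_isCyclotomic_of_tower'`
(`ClassicalMuVanishesIffBoundedRank`, g22: finite level, no growth theorem), after which the UNPRIMED public theorems (Kuroda road, modulo
Ferrero–Washington alone) apply:

* `classicalMuVanishes_of_isCyclotomic_of_nonsplitCartanNormalizer_three_fixedField''` — `L/ℚ` Galois with a faithful representation onto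
  `C_ns⁺(3)`, `s` an involution with `ρ s ≠ ±1`: «`μ = 0` for the cyclotomic `ℤ_3`-towers of `L^{⟨s⟩}`» ⟹ the same for `L`, modulo `hFW` only;
* `classicalMuVanishes_divisionField_of_hasModPImageEqNonsplitCartanNormalizer_three''` — `E/ℚ` with `HasModPImageEqNonsplitCartanNormalizer E 3`,
  `τ ∈ Γ_ℚ` an involution `≠ ±1` on `E[3]`: «`μ = 0` for the cyclotomic `ℤ_3`-towers of the fixed field of `τ|_{ℚ(E[3])}` (`= ℚ(P)`)» ⟹
  the same for `ℚ(E[3])`, modulo `hFW` only — the hypothesis of Coates–Sujatha's road (b) at `p = 3`.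

References: [Serre1972] §2.2; [FurioLombardo2023] (1.1), Thm. 1.5; [Lemmermeyer1994] §1; [Washington1997] §7.5, §13.1, §13.3 Prop. 13.23;
[NeukirchANT1999] Ch. III §1 Prop. (1.6) (ii).
-/

noncomputable section

open scoped NumberField Matrix

open Field IntermediateField WeierstrassCurve Literature.NumberTheory.EllipticCurves Literature.NumberTheory.GaloisRepresentations
  Literature.NumberTheory.SerreUniformity Literature.NumberTheory.EllipticCurves.ZpExtension

namespace Literature.NumberTheory.IwasawaTheory

/-! ### §0 Small private facts (re-proved: the versions of the g11 files are private) -/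

/-- Orders in `C_ns(3) ≅ 𝔽₉ˣ` divide `8`. [folklore] -/
private theorem c_pow_eight' : ∀ a b : ZMod 3, (a, b) ≠ (0, 0) →
    (!![a, 2 * b; b, a] : Matrix (Fin 2) (Fin 2) (ZMod 3)) ^ 8 = 1 := by
  decide

/-- Orders in `C_ns⁺(3) ∖ C_ns(3)` divide `8`. [folklore] -/
private theorem n_pow_eight' : ∀ a b : ZMod 3, (a, b) ≠ (0, 0) →
    (!![a, -(2 * b); b, -a] : Matrix (Fin 2) (Fin 2) (ZMod 3)) ^ 8 = 1 := by
  decide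

/-- Every element of `C_ns⁺(3)` has order dividing `8`. [folklore] -/
private theorem pow_eight_eq_one_of_mem' {A : Matrix (Fin 2) (Fin 2) (ZMod 3)}
    (hA : A ∈ nonsplitCartanNormalizer (2 : ZMod 3)) : A ^ 8 = 1 := by
  obtain ⟨a, b, hab, rfl | rfl⟩ := hA
  exacts [c_pow_eight' a b hab, n_pow_eight' a b hab]

/-- `3 ∤ [L : ℚ]` when `Gal(L/ℚ)` embeds in `C_ns⁺(3)` (orders divide `8`). [cite: Serre1972, §2.2] -/
private theorem not_three_dvd_finrank' (L : Type) [Field L] [NumberField L] [IsGalois ℚ L]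
    (ρ : (L ≃ₐ[ℚ] L) →* Matrix (Fin 2) (Fin 2) (ZMod 3)) (hρ : Function.Injective ρ)
    (himg : ∀ g, ρ g ∈ nonsplitCartanNormalizer (2 : ZMod 3)) : ¬ 3 ∣ Module.finrank ℚ L := by
  rw [← IsGalois.card_aut_eq_finrank ℚ L]
  intro h3
  obtain ⟨g, hg⟩ := exists_prime_orderOf_dvd_card' 3 h3
  have h8 : g ^ 8 = 1 := hρ (by rw [map_pow, map_one]; exact pow_eight_eq_one_of_mem' (himg g))
  have hdvd : orderOf g ∣ 8 := orderOf_dvd_of_pow_eq_one h8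
  rw [hg] at hdvd
  exact absurd hdvd (by decide)

/-- The non-squares of `𝔽₃`: only `2 = −1`. [folklore] -/
private theorem eq_two_of_not_isSquare' {ε : ZMod 3} (hε : ¬ IsSquare ε) : ε = 2 := by
  have key : ∀ e : ZMod 3, e = 0 ∨ e = 1 ∨ e = 2 := by decide
  rcases key ε with h | h | h
  · exact absurd ⟨0, by rw [h, mul_zero]⟩ hε
  · exact absurd ⟨1, by rw [h, mul_one]⟩ hε
  · exact h

/-- `−1 ∈ C_ns⁺(3)` (`a = 2`, `b = 0`). [folklore] -/
private theorem neg_one_mem_nonsplitCartanNormalizer_three : (-1 : Matrix (Fin 2) (Fin 2) (ZMod 3)) ∈ nonsplitCartanNormalizer (2 : ZMod 3) :=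
  ⟨2, 0, by decide, Or.inl (by decide)⟩

/-- `p ∤ [E : F]` for an intermediate field `E` of `L/F` when `p ∤ [L : F]`. [folklore] -/
private theorem not_dvd_finrank_intermediateField'' {F : Type} [Field F] {p : ℕ} {L : Type} [Field L] [Algebra F L]
    [FiniteDimensional F L] (hp : ¬ p ∣ Module.finrank F L) (E : IntermediateField F L) : ¬ p ∣ Module.finrank F ↥E := fun h =>
  hp (h.trans (Dvd.intro _ (Module.finrank_mul_finrank F ↥E L)))

/-- `Γ_ℚ → Gal(ℚ(E[n])/ℚ)` is onto. [folklore] -/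
private theorem absRestrictNormalHom_surjective_dF' {F : Type*} [Field F] (E : IntermediateField F (AlgebraicClosure F))
    [Normal F E] : Function.Surjective (absRestrictNormalHom E) := fun g => by
  obtain ⟨σ, hσ⟩ := AlgEquiv.restrictNormalHom_surjective (AlgebraicClosure F) g
  exact ⟨(absoluteGaloisGroup.toAlgEquiv F).symm σ, hσ⟩

/-- Two matrices with the same action on the vectors `e P` are equal. [folklore] -/
private theorem matrix_eq_of_forall_mulVec' {A : Type*} [AddCommGroup A] {n : ℕ} (e : A ≃+ (Fin 2 → ZMod n))
    {M N : Matrix (Fin 2) (Fin 2) (ZMod n)} (h : ∀ P : A, M *ᵥ e P = N *ᵥ e P) : M = N :=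
  Matrix.toLin'.injective (LinearMap.ext fun v => by
    rw [Matrix.toLin'_apply, Matrix.toLin'_apply, ← e.apply_symm_apply v, h])

/-! ### §1 Fixed-field form: input `L^{⟨s⟩}` alone, hI-free -/

/-- **`μ = 0` for the cyclotomic `ℤ_3`-tower of `L` from a faithful representation of `Gal(L/ℚ)` ONTO `C_ns⁺(3)` and `μ(L^{⟨s⟩}) = 0` ALONE,
modulo Ferrero–Washington, WITHOUT the growth theorem** (hI-free twin of `…_nonsplitCartanNormalizer_three_fixedField'`): the input for
`L^{⟨s⟩ ⊔ ⟨z⟩}` (`ρ z = −1`; `= ℚ(x(P))`, index `2` in `L^{⟨s⟩} = ℚ(P)`) is DERIVED by `classicalMuVanishes_of_isCyclotomic_of_tower'`, then the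
Kuroda road `…_fixedField` applies. [cite: Serre1972, §2.2 (non-split Cartan subgroups and their normalisers)] [cite: Washington1997, §7.5, §13.1]
[cite: Lemmermeyer1994, §1 (Kuroda's class number formula, odd part)] [cite: NeukirchANT1999, Ch. III §1 Prop. (1.6) (ii)] -/
theorem classicalMuVanishes_of_isCyclotomic_of_nonsplitCartanNormalizer_three_fixedField''
    (hFW : ferreroWashington1979_classicalMuVanishes)
    (L : Type) [Field L] [NumberField L] [IsGalois ℚ L]
    (ρ : (L ≃ₐ[ℚ] L) →* Matrix (Fin 2) (Fin 2) (ZMod 3)) (hρ : Function.Injective ρ) {ε : ZMod 3} (hε : ¬ IsSquare ε)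
    (himg : ∀ g, ρ g ∈ nonsplitCartanNormalizer ε) (hsurj : ∀ M ∈ nonsplitCartanNormalizer ε, ∃ g, ρ g = M)
    {s : L ≃ₐ[ℚ] L} (hss : s * s = 1) (hs1 : ρ s ≠ 1) (hs2 : ρ s ≠ -1)
    (hμ : ∀ κE : ZpExtension ↥(fixedField (Subgroup.zpowers s)) 3, κE.IsCyclotomic → ClassicalMuVanishes κE)
    (κL : ZpExtension L 3) (hκL : κL.IsCyclotomic) : ClassicalMuVanishes κL := by
  obtain rfl := eq_two_of_not_isSquare' hε
  obtain ⟨z, hz⟩ := hsurj (-1) neg_one_mem_nonsplitCartanNormalizer_three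
  have hp : ¬ 3 ∣ Module.finrank ℚ L := not_three_dvd_finrank' L ρ hρ himg
  obtain ⟨κ, hκ⟩ := exists_cyclotomicZpExtension_holds ℚ 3
  have hle : fixedField (Subgroup.zpowers s ⊔ Subgroup.zpowers z) ≤ fixedField (Subgroup.zpowers s) :=
    IntermediateField.fixedField_le le_sup_left
  have hμ' : ∀ κE : ZpExtension ↥(fixedField (Subgroup.zpowers s ⊔ Subgroup.zpowers z)) 3,
      κE.IsCyclotomic → ClassicalMuVanishes κE := by
    letI : Algebra ↥(fixedField (Subgroup.zpowers s ⊔ Subgroup.zpowers z)) ↥(fixedField (Subgroup.zpowers s)) :=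
      (IntermediateField.inclusion hle).toRingHom.toAlgebra
    haveI : IsScalarTower ℚ ↥(fixedField (Subgroup.zpowers s ⊔ Subgroup.zpowers z)) ↥(fixedField (Subgroup.zpowers s)) :=
      IsScalarTower.of_algebraMap_eq fun _ => rfl
    exact classicalMuVanishes_of_isCyclotomic_of_tower' κ hκ ↥(fixedField (Subgroup.zpowers s ⊔ Subgroup.zpowers z))
      ↥(fixedField (Subgroup.zpowers s)) (not_dvd_finrank_intermediateField'' hp _) hμ
  exact classicalMuVanishes_of_isCyclotomic_of_nonsplitCartanNormalizer_three_fixedField hFW L ρ hρ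
    (by decide : ¬ IsSquare (2 : ZMod 3)) himg hsurj hss hs1 hs2 hz hμ hμ' κL hκL

/-! ### §2 `μ = 0` for `ℚ(E[3])_cyc` from `μ(ℚ(P)) = 0` alone, hI-free -/

/-- `…_fixedField''` for any `ℚ`-algebra structure on `L` (all coincide: `Subsingleton (Algebra ℚ L)`). [cite: Serre1972, §2.2] -/
private theorem nonsplit_fixedField_alg'' (hFW : ferreroWashington1979_classicalMuVanishes)
    (L : Type) [Field L] [NumberField L] [alg : Algebra ℚ L] [IsGalois ℚ L]
    (ρ : (L ≃ₐ[ℚ] L) →* Matrix (Fin 2) (Fin 2) (ZMod 3)) (hρ : Function.Injective ρ) {ε : ZMod 3} (hε : ¬ IsSquare ε)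
    (himg : ∀ g, ρ g ∈ nonsplitCartanNormalizer ε) (hsurj : ∀ M ∈ nonsplitCartanNormalizer ε, ∃ g, ρ g = M)
    {s : L ≃ₐ[ℚ] L} (hss : s * s = 1) (hs1 : ρ s ≠ 1) (hs2 : ρ s ≠ -1)
    (hμ : ∀ κE : ZpExtension ↥(fixedField (Subgroup.zpowers s)) 3, κE.IsCyclotomic → ClassicalMuVanishes κE)
    (κL : ZpExtension L 3) (hκL : κL.IsCyclotomic) : ClassicalMuVanishes κL := by
  have h : alg = DivisionRing.toRatAlgebra := Subsingleton.elim _ _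
  subst h
  exact classicalMuVanishes_of_isCyclotomic_of_nonsplitCartanNormalizer_three_fixedField'' hFW L ρ hρ hε himg hsurj hss hs1 hs2
    hμ κL hκL

/-- **Non-split Cartan image, input `ℚ(P)` alone, modulo Ferrero–Washington, WITHOUT the growth theorem** (hI-free twin of
`classicalMuVanishes_divisionField_of_hasModPImageEqNonsplitCartanNormalizer_three'`): `E/ℚ` elliptic with `HasModPImageEqNonsplitCartanNormalizer E 3`,
`τ ∈ Γ_ℚ` acting on `E[3]` as an involution `≠ 1, −1`; if `μ = 0` holds for every cyclotomic `ℤ_3`-extension of the fixed field of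
`τ|_{ℚ(E[3])}` (`= ℚ(P)`, degree `8`), then for every cyclotomic `ℤ_3`-extension of `ℚ(E[3])` — the hypothesis of Coates–Sujatha's road (b)
at `p = 3`. [cite: Serre1972, §2.2 (non-split Cartan subgroups and their normalisers)] [cite: FurioLombardo2023, Thm. 1.5]
[cite: Washington1997, §7.5, §13.1] [cite: Lemmermeyer1994, §1 (Kuroda's class number formula, odd part)] -/
theorem classicalMuVanishes_divisionField_of_hasModPImageEqNonsplitCartanNormalizer_three''
    (hFW : ferreroWashington1979_classicalMuVanishes)
    (W : WeierstrassCurve ℚ) [W.IsElliptic] (himg : HasModPImageEqNonsplitCartanNormalizer W 3) (τ : absoluteGaloisGroup ℚ)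
    (hτ2 : ∀ T : W.geomTorsion (3 : ℕ), τ • (τ • T) = T) (hτ1 : ∃ T : W.geomTorsion (3 : ℕ), τ • T ≠ T)
    (hτm : ∃ T : W.geomTorsion (3 : ℕ), τ • T ≠ -T)
    (hμ : haveI : NumberField ↥(W.divisionField 3) := NumberField.mk
      ∀ κE : ZpExtension ↥(fixedField (Subgroup.zpowers (absRestrictNormalHom (W.divisionField 3) τ))) 3,
        κE.IsCyclotomic → ClassicalMuVanishes κE) :
    haveI : NumberField ↥(W.divisionField 3) := NumberField.mk
    ∀ κL : ZpExtension ↥(W.divisionField 3) 3, κL.IsCyclotomic → ClassicalMuVanishes κL := by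
  haveI : NumberField ↥(W.divisionField 3) := NumberField.mk
  intro κL hκL
  obtain ⟨e, ε, hε, he, hsurjM⟩ := himg
  obtain ⟨ρ, hρ, hρe⟩ := exists_matrixRep_divisionField W 3 e
  have hπ := absRestrictNormalHom_surjective_dF' (W.divisionField 3)
  have hmat : ∀ (σ : absoluteGaloisGroup ℚ) (M : Matrix (Fin 2) (Fin 2) (ZMod 3)),
      (∀ P : W.geomTorsion (3 : ℕ), e (σ • P) = M *ᵥ e P) → ρ (absRestrictNormalHom (W.divisionField 3) σ) = M :=
    fun σ M hM => matrix_eq_of_forall_mulVec' e fun P => by rw [← hρe, hM]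
  have himg' : ∀ g, ρ g ∈ nonsplitCartanNormalizer ε := fun g => by
    obtain ⟨σ, rfl⟩ := hπ g
    obtain ⟨M, hM, hMe⟩ := he σ
    rw [hmat σ M hMe]
    exact hM
  have hsurj' : ∀ M ∈ nonsplitCartanNormalizer ε, ∃ g, ρ g = M := fun M hM => by
    obtain ⟨σ, hσ⟩ := hsurjM M hM
    exact ⟨_, hmat σ M hσ⟩
  have hss : absRestrictNormalHom (W.divisionField 3) τ * absRestrictNormalHom (W.divisionField 3) τ = 1 := by
    rw [← map_mul, W.absRestrictNormalHom_divisionField_eq_one_iff 3]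
    intro T
    rw [mul_smul]
    exact hτ2 T
  have hs1 : ρ (absRestrictNormalHom (W.divisionField 3) τ) ≠ 1 := fun h => by
    obtain ⟨T, hT⟩ := hτ1
    exact hT (e.injective (by rw [hρe, h, Matrix.one_mulVec]))
  have hs2 : ρ (absRestrictNormalHom (W.divisionField 3) τ) ≠ -1 := fun h => by
    obtain ⟨T, hT⟩ := hτm
    exact hT (e.injective (by rw [hρe, h, Matrix.neg_mulVec, Matrix.one_mulVec, map_neg]))
  exact @nonsplit_fixedField_alg'' hFW ↥(W.divisionField 3) _ _ (_) (W.isGalois_divisionField 3) ρ hρ ε hε himg' hsurj' _ hss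
    hs1 hs2 hμ κL hκL

end Literature.NumberTheory.IwasawaTheory

end
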